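import Summits.HodgeConjecture.CorCM.MumfordTateRankTypeIVTimesCMCurveRigid
import Summits.HodgeConjecture.CorCM.Assembly.CMEllipticCurvesIsogenyFields
import HarnessLib

/-!
# Ribet type `(g − 1, 1)` × two CM elliptic curves: `t(A × E₁ × E₂) ∈ {g² + 1, g² + 2, g² + 3}`, every cell exact — `g² + 1` iff both curves carry
# `√−D` (`End⁰A = ℚ(√−D)`), `g² + 3` iff the three fields are pairwise foreign, `g² + 2` otherwise (Moonen–Zarhin 1999 Thm. 0.1 (4), §3 (3.1), (3.8), all `g ≥ 3`)

COR-CM (cell `pub-hodgecm2`, seat `b27` gen 50, count-neutral Mumford–Tate-rank ladder; theorems only, no definition, no named fact;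
UNCONDITIONAL — nothing here uses or asserts HC_CM).  Notation `t(X) = dim MT(H¹X)`, `g = dim A ≥ 3`, `A` of Ribet type `(g − 1, 1)`: `End⁰A` a field of
`ℚ`-dimension `2`, not totally real, `φ ∘ φ = −D` with multiplicity one at `i√D` or `−i√D` on `H^{1,0}(A)` (`t(A) = g² + 1`, `Hg(A) = U(g−1,1)`).

The all-`g` version of the CM × CM column of `CorCM/MumfordTateRankTypeIVThreefoldTimesCurves` (`g = 3`: `10 / 11 / 11 / 12`):
* `E₁`, `E₂` both admit `χ ∘ χ = −D`           : `g² + 1` (then `E₁ ∼ E₂`; duplicate factor and `CorCM/MumfordTateRankRibetTimesCMCurveSameField`);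
* `End⁰E₁ ↛ End⁰A`, `E₂` admits `χ ∘ χ = −D`    : `g² + 2` (`CorCM/MumfordTateRankTypeIVTimesCMCurveRigid`);
* `End⁰E₁ ↛ End⁰A`, `E₁ ∼ E₂`                   : `g² + 2` (duplicate factor and Prop. (3.8));
* `End⁰E₁`, `End⁰E₂`, `End⁰A` pairwise foreign  : `g² + 3` (`CorCM/MumfordTateRankTypeIVTimesTwoCMCurvesCells`);
and for ANY two CM curves `g² + 1 ≤ t ≤ g² + 3` (rigid-factor monotonicity and subadditivity).

## References
* [MoonenZarhin1999LowDim] B. Moonen, Yu. G. Zarhin, *Hodge classes on abelian varieties of low dimension*, Math. Ann. 315 (1999), Thm. 0.1 (4),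
  §3 (3.1), Prop. (3.8) [corpus: paper:arxiv-math_9901113 pp. 1, 6–7]. [cite: MoonenZarhin1999LowDim, Thm. 0.1 (4), §3 (3.1) and (3.8)]
* [Ribet1983] K. A. Ribet, Amer. J. Math. 105 (1983), Thm. 3. [cite: Ribet1983, Thm. 3]
* [SilvermanAdvancedTopics1994] J. H. Silverman, *Advanced Topics in the Arithmetic of Elliptic Curves*, II §1 Prop. 1.2. [cite: SilvermanAdvancedTopics1994, II §1 Prop. 1.2 and Prop. 1.4]
-/

noncomputable section

open CategoryTheory CategoryTheory.Limits Module

namespace Summit.HodgeConjecture.CorCM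

open Literature.AlgebraicGeometry.Motives
open Literature.AlgebraicGeometry.Motives.AbelianVariety
open Literature.AlgebraicGeometry.Motives.HodgeStructure
open Literature.AlgebraicGeometry.HodgeTheory
open Literature.AlgebraicGeometry.ComplexMultiplication
open Literature.AlgebraicGeometry.Milne1999 (IsOfCMType)

variable [HodgeTensorFacts.{0, 0}] {X A E₁ E₂ : AbelianVariety ℂ} {n : ℕ}

/-- **Both curves carry `√−D`: `t(A × E₁ × E₂) = g² + 1`** (`A` of Ribet type `(g − 1, 1)` with `φ ∘ φ = −D`; `χ₁ ∘ χ₁ = −D` on `E₁`, `χ₂ ∘ χ₂ = −D` on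
`E₂`): `E₁ ∼ E₂` (same CM discriminant), the second curve is a duplicate factor, and `t(E₁ × A) = g² + 1` (codimension one in `Hg(A) × Hg(E₁)`).
[cite: MoonenZarhin1999LowDim, Thm. 0.1 (4), §3 (3.1) and (3.8)] [cite: Ribet1983, Thm. 3] [cite: SilvermanAdvancedTopics1994, II §1 Prop. 1.2 and Prop. 1.4] -/
theorem mtRank_hodge_one_of_isIsogenous_ribetTypeOne_prod_cmCurves_sameField (hX : IsSmoothProjective n X.X) (hF : IsField A.endAlgebra)
    (hnR : ¬ NumberField.IsTotallyReal (EndField A hF)) (φ : A ⟶ A) {D : ℕ} (hD : 0 < D) (hφ : φ ≫ φ = -(D • 𝟙 A))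
    (hA2 : Module.finrank ℚ A.endAlgebra = 2)
    (h1 : eigenMultiplicity A φ (Complex.I * (Real.sqrt D : ℂ)) = 1 ∨ eigenMultiplicity A φ (-(Complex.I * (Real.sqrt D : ℂ))) = 1)
    (hdim : 3 ≤ A.dim) (hE₁1 : E₁.dim = 1) {χ₁ : E₁ ⟶ E₁} (hχ₁ : χ₁ ≫ χ₁ = -(D • 𝟙 E₁)) (hE₂1 : E₂.dim = 1) {χ₂ : E₂ ⟶ E₂}
    (hχ₂ : χ₂ ≫ χ₂ = -(D • 𝟙 E₂)) (hXP : IsIsogenous X (A.prod (E₁.prod E₂))) :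
    haveI := BettiUniverse.finite hX 1
    (BettiUniverse.hodge exists_isReal_hodgeModel_holds hX 1).mtRank = A.dim * A.dim + 1 := by
  haveI := BettiUniverse.finite hX 1
  have h12 : IsIsogenous E₁ E₂ := PeriodCurve.isIsogenous_of_cm_same hE₁1 hE₂1 hD hχ₁ hχ₂
  have hY : IsSmoothProjective (A.prod E₁).dim (A.prod E₁).X := AbelianVariety.isSmoothProjective_holds
  haveI := BettiUniverse.finite hY 1
  have hXQ : IsIsogenous X ((A.prod E₁).prod E₁) :=
    (hXP.trans ((IsIsogenous.refl A).prod ((IsIsogenous.refl E₁).prod h12.symm'))).trans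
      (Literature.AlgebraicGeometry.HodgeTheory.isIsogenous_prod_assoc A E₁ E₁).symm'
  have hdup := mtRank_hodge_one_eq_of_isIsogenous_prod_prod_self hX hY (by rw [dim_prod]; omega) hXQ (IsIsogenous.refl _)
  have h := mtRank_hodge_one_eq_of_isIsogenous_ribetTypeOne_prod_cmCurve_of_exists_comp_self_eq_neg hY hF hnR φ hD hφ hA2 h1 hdim hE₁1 ⟨χ₁, hχ₁⟩
    (isIsogenous_prod_comm A E₁)
  omega

/-- **`End⁰E₁ ↛ End⁰A` and `E₁ ∼ E₂`: `t(A × E₁ × E₂) = g² + 2`** (duplicate factor; `t(E₁ × A) = g² + 2` by Prop. (3.8)).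
[cite: MoonenZarhin1999LowDim, §3 (3.1) and (3.8)] [cite: Ribet1983, Thm. 3] -/
theorem mtRank_hodge_one_of_isIsogenous_ribetTypeOne_prod_cmCurves_of_isEmpty_of_isIsogenous (hX : IsSmoothProjective n X.X)
    (hF : IsField A.endAlgebra) (hnR : ¬ NumberField.IsTotallyReal (EndField A hF)) (φ : A ⟶ A) {D : ℕ} (hD : 0 < D) (hφ : φ ≫ φ = -(D • 𝟙 A))
    (hA2 : Module.finrank ℚ A.endAlgebra = 2)
    (h1 : eigenMultiplicity A φ (Complex.I * (Real.sqrt D : ℂ)) = 1 ∨ eigenMultiplicity A φ (-(Complex.I * (Real.sqrt D : ℂ))) = 1)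
    (hdim : 3 ≤ A.dim) (hE₁1 : E₁.dim = 1) (hE₁cm : IsOfCMType E₁) (hfor : IsEmpty (E₁.endAlgebra →+* A.endAlgebra)) (h12 : IsIsogenous E₁ E₂)
    (hXP : IsIsogenous X (A.prod (E₁.prod E₂))) :
    haveI := BettiUniverse.finite hX 1
    (BettiUniverse.hodge exists_isReal_hodgeModel_holds hX 1).mtRank = A.dim * A.dim + 2 := by
  haveI := BettiUniverse.finite hX 1
  have hY : IsSmoothProjective (A.prod E₁).dim (A.prod E₁).X := AbelianVariety.isSmoothProjective_holds
  haveI := BettiUniverse.finite hY 1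
  have hXQ : IsIsogenous X ((A.prod E₁).prod E₁) :=
    (hXP.trans ((IsIsogenous.refl A).prod ((IsIsogenous.refl E₁).prod h12.symm'))).trans
      (Literature.AlgebraicGeometry.HodgeTheory.isIsogenous_prod_assoc A E₁ E₁).symm'
  have hdup := mtRank_hodge_one_eq_of_isIsogenous_prod_prod_self hX hY (by rw [dim_prod]; omega) hXQ (IsIsogenous.refl _)
  have h := mtRank_hodge_one_of_isIsogenous_cmCurve_prod_ribetTypeOne_of_isEmpty_ringHom hY hE₁1 hE₁cm hF hnR φ hD hφ hA2 h1 hdim hfor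
    (isIsogenous_prod_comm A E₁)
  omega

/-- **Ribet type `(g − 1, 1)` × ANY two CM curves: `g² + 1 ≤ t(A × E₁ × E₂) ≤ g² + 3`** (`t(A) ≤ t` by the `Θ`-rigidity of `A`,
`CorCM/MumfordTateRankRigidMonotone`; `t + 2 ≤ t(A) + t(E₁) + t(E₂)` by subadditivity), so `t ∈ {g² + 1, g² + 2, g² + 3}` — with the exact cells of this
file, `CorCM/MumfordTateRankTypeIVTimesCMCurveRigid` (`g² + 2` for `End⁰E₁ ↛ End⁰A`, `χ₂ ∘ χ₂ = −D`) and `CorCM/MumfordTateRankTypeIVTimesTwoCMCurvesCells`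
(`g² + 3` for pairwise foreign fields). [cite: MoonenZarhin1999LowDim, §3 (3.1) and (3.8)] [cite: Ribet1983, Thm. 3] -/
theorem mtRank_hodge_one_mem_of_isIsogenous_ribetTypeOne_prod_cmCurves (hX : IsSmoothProjective n X.X) (hF : IsField A.endAlgebra)
    (hnR : ¬ NumberField.IsTotallyReal (EndField A hF)) (φ : A ⟶ A) {D : ℕ} (hD : 0 < D) (hφ : φ ≫ φ = -(D • 𝟙 A))
    (hA2 : Module.finrank ℚ A.endAlgebra = 2)
    (h1 : eigenMultiplicity A φ (Complex.I * (Real.sqrt D : ℂ)) = 1 ∨ eigenMultiplicity A φ (-(Complex.I * (Real.sqrt D : ℂ))) = 1)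
    (hdim : 3 ≤ A.dim) (hE₁1 : E₁.dim = 1) (hE₁cm : IsOfCMType E₁) (hE₂1 : E₂.dim = 1) (hE₂cm : IsOfCMType E₂)
    (hXP : IsIsogenous X (A.prod (E₁.prod E₂))) :
    haveI := BettiUniverse.finite hX 1
    (BettiUniverse.hodge exists_isReal_hodgeModel_holds hX 1).mtRank ∈ ({A.dim * A.dim + 1, A.dim * A.dim + 2, A.dim * A.dim + 3} : Finset ℕ) := by
  haveI := BettiUniverse.finite hX 1
  have hA : IsSmoothProjective A.dim A.X := AbelianVariety.isSmoothProjective_holds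
  have hY : IsSmoothProjective (A.prod E₁).dim (A.prod E₁).X := AbelianVariety.isSmoothProjective_holds
  have hE₁ : IsSmoothProjective E₁.dim E₁.X := AbelianVariety.isSmoothProjective_holds
  have hE₂ : IsSmoothProjective E₂.dim E₂.X := AbelianVariety.isSmoothProjective_holds
  haveI := BettiUniverse.finite hA 1
  haveI := BettiUniverse.finite hY 1
  haveI := BettiUniverse.finite hE₁ 1
  haveI := BettiUniverse.finite hE₂ 1
  have hgg := (mtRank_hodge_one_of_ribetTypeOne' hA hF hnR φ hD hφ hA2 h1 hdim).1
  -- lower bound: `A` is `Θ`-rigid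
  have hge := mtRank_hodge_one_le_of_isIsogenous_prod_of_rigid (X₂ := E₁.prod E₂) hX hA (by omega)
    (hodgeLie_rigid_of_ribetTypeOne hA φ hD hφ hA2 h1 hdim) hXP
  -- upper bound: subadditivity twice
  have h2₁ := mtRank_hodge_one_eq_two_of_cm_curve hE₁1 hE₁cm
  have h2₂ := mtRank_hodge_one_eq_two_of_cm_curve hE₂1 hE₂cm
  have hle₁ := mtRank_hodge_one_add_one_le_add_of_isIsogenous_prod hA hE₁ (by omega) (by omega) hY (IsIsogenous.refl _)
  have hle := mtRank_hodge_one_add_one_le_add_of_isIsogenous_prod hY hE₂ (by rw [dim_prod]; omega) (by omega) hX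
    (hXP.trans (Literature.AlgebraicGeometry.HodgeTheory.isIsogenous_prod_assoc A E₁ E₂).symm')
  simp only [Finset.mem_insert, Finset.mem_singleton]
  omega

end Summit.HodgeConjecture.CorCM

end
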